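import Summits.QuantumFields.YangMills.Theorems.ColdStartUniversalityLatticeLangevinBatchMeansCentred
import Summits.QuantumFields.YangMills.Theorems.ColdStartUniversalityLatticeLangevinAsymptoticVarianceNonneg
import Summits.QuantumFields.YangMills.Theorems.ColdStartUniversalityLatticeLangevinRegularFlow
import Mathlib.MeasureTheory.Function.ConvergenceInMeasure
import HarnessLib

/-!
# Route `ColdStartUniversality` (fixed-cut-off SZZ dynamics, sampler package): THE CENTRED BATCH-MEANS ESTIMATOR IS CONSISTENT IN
# PROBABILITY — `σ̂²_n → σ²(G)` in measure along every block scheme `b_n → ∞`, `J_n → ∞`, `b_n/J_n → 0`, every strong solution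

Helper file (seat `ym-line-csu-p1`, g35; `--supports stmt-QuantumFields-24809`).  File 88 bounded the `L¹` error of the CENTRED (unknown-mean)
batch-means estimator of the asymptotic variance along progressively measurable solutions.  This file turns it into the form needed by Slutsky's
theorem for the studentised CLT (next file): for every coupling, realising kernel family, EVERY strong solution `U` from a deterministic start on
ANY space, every continuous `|G| ≤ 1`, and every block scheme `b_n > 0`, `J_n ≥ 1` with `b_n → ∞`, `J_n → ∞`, `b_n/J_n → 0`, the estimator computed
FROM THE DATA ALONE (no centring by the unknown mean `μ_(β')G`)

  `σ̂²_n = (b_n/J_n) Σ_(j<J_n) (a_j − ā)²`,  `a_j = b_n⁻¹ ∫_(jb_n,(j+1)b_n] G(U_r) dr`,  `ā = (J_n b_n)⁻¹ Σ_j ∫_(jb_n,(j+1)b_n] G(U_r) dr`,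

converges IN PROBABILITY to `σ²(G) = 2∫₀^∞⟨Ĝ,κ_tĜ⟩_μ dt` (★★★ `tendstoInMeasure_centredBatchMeans`, Mathlib's `TendstoInMeasure`).  Proof: the
estimator is invariant under `G ↦ G − μG`, so it equals file 88's; its `L¹` bound `√((8bσ²+8K+2σ⁴)/J + K(2σ²+K/b)/b) + σ²/J + K/(J²b) → 0`;
Markov's inequality; regular flow + pathwise uniqueness for arbitrary solutions (`TendstoInMeasure.congr`).  THEOREMS ONLY, no definition, no sorry;
[folklore].  HONEST FRAMING: fixed cut-off; `K`, `σ²` depend on `L, β'`; `UniformColdStartMixing` (24809) is NOT restated; no crux, rung or summit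
statement is proved; the Yang–Mills mass gap is NOT proved.
-/

set_option autoImplicit false

noncomputable section

namespace Summit.QuantumFields.YangMills.Theorems.ColdStartUniversality

open MeasureTheory ProbabilityTheory Filter Topology Set
open scoped NNReal ENNReal BigOperators
open Literature Literature.Probability.Process Literature.MathematicalPhysics.QuantumFieldTheory
open Literature.MathematicalPhysics.QuantumLattice (fundamentalRep fundamentalLatticeRep continuous_fundamentalRep)

variable {L : ℕ} [NeZero L]

/-- ★★★ **Consistency in probability of the centred batch-means estimator along every admissible block scheme, every strong solution.**
See the module docstring. [folklore] -/
theorem tendstoInMeasure_centredBatchMeans (L : ℕ) [NeZero L] (β' : ℝ)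
    (κ : ℝ≥0 → Kernel (GaugeConfig 3 L (Matrix.specialUnitaryGroup (Fin 2) ℂ))
      (GaugeConfig 3 L (Matrix.specialUnitaryGroup (Fin 2) ℂ))) [∀ t, IsMarkovKernel (κ t)]
    (hreal : ∀ (t : ℝ≥0) (x : GaugeConfig 3 L (Matrix.specialUnitaryGroup (Fin 2) ℂ))
        (Ω : Type) [MeasurableSpace Ω] (P : Measure Ω) [IsProbabilityMeasure P]
        (W : ℝ≥0 → Ω → (Edge 3 L × NoiseIdx 2 → ℝ)) (hW : IsFlatBrownian W P)
        (U : ℝ≥0 → Ω → GaugeConfig 3 L (Matrix.specialUnitaryGroup (Fin 2) ℂ)),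
        (∀ ω, U 0 ω = x) →
        (latticeLangevinDynamics (fundamentalLatticeRep 2) β').IsSolution (fundamentalRep (Fin 2))
          hW.natFiltration P W U →
        κ t x = P.map (U t))
    (x : GaugeConfig 3 L (Matrix.specialUnitaryGroup (Fin 2) ℂ))
    {Ω : Type} [MeasurableSpace Ω] {P : Measure Ω} [IsProbabilityMeasure P]
    {W : ℝ≥0 → Ω → (Edge 3 L × NoiseIdx 2 → ℝ)} (hW : IsFlatBrownian W P)
    {U : ℝ≥0 → Ω → GaugeConfig 3 L (Matrix.specialUnitaryGroup (Fin 2) ℂ)} (hU0 : ∀ ω, U 0 ω = x)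
    (hU : (latticeLangevinDynamics (fundamentalLatticeRep 2) β').IsSolution (fundamentalRep (Fin 2)) hW.natFiltration P W U)
    {G : GaugeConfig 3 L (Matrix.specialUnitaryGroup (Fin 2) ℂ) → ℝ} (hGc : Continuous G) (hG1 : ∀ z, |G z| ≤ 1)
    {σ2 : ℝ} (hσ2 : σ2 = 2 * ∫ t in Ioi (0 : ℝ),
        (∫ y, (G y - ∫ z, G z ∂(wilsonMeasure (d := 3) (L := L) (fundamentalRep (Fin 2)) β')) *
          (∫ z, (G z - ∫ z', G z' ∂(wilsonMeasure (d := 3) (L := L) (fundamentalRep (Fin 2)) β')) ∂(κ t.toNNReal y))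
          ∂(wilsonMeasure (d := 3) (L := L) (fundamentalRep (Fin 2)) β')))
    (b : ℕ → ℝ) (J : ℕ → ℕ) (hb : ∀ n, 0 < b n) (hJ : ∀ n, 1 ≤ J n)
    (hb_top : Tendsto b atTop atTop) (hJ_top : Tendsto (fun n => (J n : ℝ)) atTop atTop)
    (hbJ : Tendsto (fun n => b n / J n) atTop (𝓝 0)) :
    0 ≤ σ2 ∧
    (∀ n, AEMeasurable (fun ω => b n / J n * ∑ j ∈ Finset.range (J n),
        ((∫ r in Ioc ((j : ℝ) * b n) (((j : ℝ) + 1) * b n), G (U r.toNNReal ω)) / b n -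
          ((J n : ℝ) * b n)⁻¹ * ∑ j' ∈ Finset.range (J n), ∫ r in Ioc ((j' : ℝ) * b n) (((j' : ℝ) + 1) * b n), G (U r.toNNReal ω)) ^ 2) P) ∧
    TendstoInMeasure P (fun n ω => b n / J n * ∑ j ∈ Finset.range (J n),
        ((∫ r in Ioc ((j : ℝ) * b n) (((j : ℝ) + 1) * b n), G (U r.toNNReal ω)) / b n -
          ((J n : ℝ) * b n)⁻¹ * ∑ j' ∈ Finset.range (J n), ∫ r in Ioc ((j' : ℝ) * b n) (((j' : ℝ) + 1) * b n), G (U r.toNNReal ω)) ^ 2)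
      atTop (fun _ => σ2) := by
  classical
  haveI := secondCountableTopology_su2
  haveI := borelSpace_config L
  set μ : Measure (GaugeConfig 3 L (Matrix.specialUnitaryGroup (Fin 2) ℂ)) :=
    wilsonMeasure (d := 3) (L := L) (fundamentalRep (Fin 2)) β' with hμ
  haveI : IsProbabilityMeasure μ :=
    isProbabilityMeasure_wilsonMeasure (d := 3) (L := L) (fundamentalRep (Fin 2)) (continuous_fundamentalRep (Fin 2)) β'
  set m : ℝ := ∫ z, G z ∂μ with hm
  have hG : Measurable G := hGc.measurable
  have hσ0 : 0 ≤ σ2 := by rw [hσ2]; exact mul_nonneg (by norm_num) (greenKubo_nonneg L β' κ hreal hGc hG1)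
  /- ### 1. Regular flow and pathwise uniqueness -/
  obtain ⟨V, -, hV, hVprog, -, -, -⟩ := exists_regularFlow L β' hW
  have hprog : ∀ i : ℝ≥0, Measurable[@Prod.instMeasurableSpace (Set.Iic i) Ω inferInstance (hW.natFiltration i)]
      (fun q : Set.Iic i × Ω => V x q.1 q.2) := fun i =>
    (hVprog i).comp (measurable_fst.prodMk (measurable_const.prodMk measurable_snd))
  have hae : ∀ᵐ ω ∂P, ∀ t, U t ω = V x t ω := latticeLangevin_pathwise_unique hW β' x hU0 (hV x).1 hU (hV x).2
  have hpathm : Measurable fun q : Ω × ℝ => V x q.2.toNNReal q.1 :=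
    measurable_uncurry_of_prog (Z := V x) (fun n : ℕ => hW.natFiltration n) (fun n => hW.natFiltration.le n) (fun n => hprog n)
  -- the block integrals of `G` and of `Ĝ = G − m` along `V`
  set I : ℕ → ℕ → Ω → ℝ := fun n j ω => ∫ r in Ioc ((j : ℝ) * b n) (((j : ℝ) + 1) * b n), G (V x r.toNNReal ω) with hI
  set Ih : ℕ → ℕ → Ω → ℝ := fun n j ω => ∫ r in Ioc ((j : ℝ) * b n) (((j : ℝ) + 1) * b n), (G (V x r.toNNReal ω) - m) with hIh
  have hIm : ∀ n j, Measurable (I n j) := fun n j => by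
    have h1 : Measurable (Function.uncurry fun (ω : Ω) (r : ℝ) => G (V x r.toNNReal ω)) := hG.comp hpathm
    exact (h1.stronglyMeasurable.integral_prod_right' (ν := volume.restrict (Ioc ((j : ℝ) * b n) (((j : ℝ) + 1) * b n)))).measurable
  have hIhI : ∀ n j ω, Ih n j ω = I n j ω - m * b n := fun n j ω => by
    have hio : IntegrableOn (fun r : ℝ => G (V x r.toNNReal ω)) (Ioc ((j : ℝ) * b n) (((j : ℝ) + 1) * b n)) volume :=
      (integrableOn_const (C := (1 : ℝ)) (hs := measure_Ioc_lt_top.ne)).mono'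
        ((hG.comp (hpathm.comp (measurable_const.prodMk measurable_id))).aestronglyMeasurable)
        (Eventually.of_forall fun r => by rw [Real.norm_eq_abs]; exact hG1 _)
    simp only [hIh, hI]
    rw [integral_sub hio (integrableOn_const (hs := measure_Ioc_lt_top.ne)), setIntegral_const, smul_eq_mul,
      Real.volume_real_Ioc_of_le (by nlinarith [hb n])]
    ring
  -- the two estimators coincide
  set est : ℕ → Ω → ℝ := fun n ω => b n / J n * ∑ j ∈ Finset.range (J n),
      (I n j ω / b n - ((J n : ℝ) * b n)⁻¹ * ∑ j' ∈ Finset.range (J n), I n j' ω) ^ 2 with hest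
  have hest_eq : ∀ n ω, est n ω = b n / J n * ∑ j ∈ Finset.range (J n),
      (Ih n j ω / b n - ((J n : ℝ) * b n)⁻¹ * ∑ j' ∈ Finset.range (J n), Ih n j' ω) ^ 2 := by
    intro n ω
    have hbn : b n ≠ 0 := (hb n).ne'
    have hJn : (J n : ℝ) ≠ 0 := by have := hJ n; positivity
    simp only [hest]
    congr 1
    refine Finset.sum_congr rfl fun j _ => ?_
    congr 1
    simp only [hIhI, Finset.sum_sub_distrib, Finset.sum_const, Finset.card_range, nsmul_eq_mul]
    field_simp
    ring
  have hestm : ∀ n, Measurable (est n) := fun n =>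
    (Finset.measurable_sum _ fun j _ => (((hIm n j).div_const _).sub
      ((Finset.measurable_sum _ fun j' _ => hIm n j').const_mul _)).pow_const 2).const_mul _
  -- a.s. equality with the `U`-estimator
  have hestU : ∀ n, (fun ω => b n / J n * ∑ j ∈ Finset.range (J n),
        ((∫ r in Ioc ((j : ℝ) * b n) (((j : ℝ) + 1) * b n), G (U r.toNNReal ω)) / b n -
          ((J n : ℝ) * b n)⁻¹ * ∑ j' ∈ Finset.range (J n), ∫ r in Ioc ((j' : ℝ) * b n) (((j' : ℝ) + 1) * b n), G (U r.toNNReal ω)) ^ 2)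
      =ᵐ[P] est n := fun n => by
    filter_upwards [hae] with ω hω
    have hfun : (fun r : ℝ => G (U r.toNNReal ω)) = fun r : ℝ => G (V x r.toNNReal ω) := funext fun r => by rw [hω]
    simp only [hest, hI, hfun]
  /- ### 2. The `L¹` bound of file 88 and its decay -/
  obtain ⟨K, hK, h88⟩ := integral_abs_centredBatchMeans_sub_le_of_prog L β'
  set Bd : ℕ → ℝ := fun n => Real.sqrt ((8 * b n * |σ2| + 8 * K + 2 * σ2 ^ 2) / J n + K * (2 * |σ2| + K / b n) / b n) +
      |σ2| / J n + K / ((J n : ℝ) ^ 2 * b n) with hBd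
  have hL1 : ∀ n, ∫ ω, |est n ω - σ2| ∂P ≤ Bd n := fun n => by
    have h := h88 κ hreal x Ω P W hW (V x) (hV x).1 (hV x).2 hprog G hGc hG1 (b n) (hb n) (J n) (hJ n)
    rw [← hσ2] at h
    refine le_of_eq_of_le (integral_congr_ae (ae_of_all _ fun ω => ?_)) h
    show |est n ω - σ2| = _
    rw [hest_eq]
  have hBd0 : Tendsto Bd atTop (𝓝 0) := by
    have hJi : Tendsto (fun n => ((J n : ℝ))⁻¹) atTop (𝓝 0) := tendsto_inv_atTop_zero.comp hJ_top
    have hbi : Tendsto (fun n => (b n)⁻¹) atTop (𝓝 0) := tendsto_inv_atTop_zero.comp hb_top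
    have h1 : Tendsto (fun n => (8 * b n * |σ2| + 8 * K + 2 * σ2 ^ 2) / J n) atTop (𝓝 0) := by
      have : Tendsto (fun n => 8 * |σ2| * (b n / J n) + (8 * K + 2 * σ2 ^ 2) * ((J n : ℝ))⁻¹) atTop (𝓝 0) := by
        simpa using (hbJ.const_mul (8 * |σ2|)).add (hJi.const_mul (8 * K + 2 * σ2 ^ 2))
      refine this.congr' (Eventually.of_forall fun n => ?_)
      simp only [div_eq_mul_inv]; ring
    have h2 : Tendsto (fun n => K * (2 * |σ2| + K / b n) / b n) atTop (𝓝 0) := by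
      have : Tendsto (fun n => K * (2 * |σ2| + K * (b n)⁻¹) * (b n)⁻¹) atTop (𝓝 0) := by
        simpa using (((hbi.const_mul K).const_add (2 * |σ2|)).const_mul K).mul hbi
      refine this.congr' (Eventually.of_forall fun n => ?_)
      simp only [div_eq_mul_inv]
    have h3 : Tendsto (fun n => Real.sqrt ((8 * b n * |σ2| + 8 * K + 2 * σ2 ^ 2) / J n + K * (2 * |σ2| + K / b n) / b n)) atTop (𝓝 0) := by
      simpa using (h1.add h2).sqrt
    have h4 : Tendsto (fun n => |σ2| / J n) atTop (𝓝 0) := by simpa [div_eq_mul_inv] using hJi.const_mul |σ2|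
    have h5 : Tendsto (fun n => K / ((J n : ℝ) ^ 2 * b n)) atTop (𝓝 0) := by
      have : Tendsto (fun n => K * (((J n : ℝ))⁻¹ ^ 2 * (b n)⁻¹)) atTop (𝓝 0) := by
        simpa using ((hJi.pow 2).mul hbi).const_mul K
      refine this.congr' (Eventually.of_forall fun n => ?_)
      simp only [div_eq_mul_inv, mul_inv, inv_pow]
    simpa [hBd] using (h3.add h4).add h5
  /- ### 3. Markov's inequality ⇒ convergence in measure (for `V`), then transfer to `U` -/
  have hestb : ∀ n ω, |est n ω| ≤ 4 * b n := fun n ω => by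
    have hIb : ∀ j, |I n j ω| ≤ b n := fun j => by
      have hh := norm_setIntegral_le_of_norm_le_const (μ := volume) (s := Ioc ((j : ℝ) * b n) (((j : ℝ) + 1) * b n)) measure_Ioc_lt_top
        (fun r _ => show ‖G (V x r.toNNReal ω)‖ ≤ 1 by rw [Real.norm_eq_abs]; exact hG1 _) (f := fun r => G (V x r.toNNReal ω))
      rw [Real.norm_eq_abs, Real.volume_real_Ioc_of_le (by nlinarith [hb n])] at hh
      calc |I n j ω| ≤ 1 * (((j : ℝ) + 1) * b n - (j : ℝ) * b n) := hh
        _ = b n := by ring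
    have hbn : 0 < b n := hb n
    have hJr : (1 : ℝ) ≤ J n := by exact_mod_cast hJ n
    have ha : ∀ j, |I n j ω / b n| ≤ 1 := fun j => by
      rw [abs_div, abs_of_pos hbn, div_le_one hbn]; exact hIb j
    have hmean : |((J n : ℝ) * b n)⁻¹ * ∑ j' ∈ Finset.range (J n), I n j' ω| ≤ 1 := by
      rw [abs_mul, abs_inv, abs_of_pos (by positivity : (0 : ℝ) < J n * b n)]
      have h1 : |∑ j' ∈ Finset.range (J n), I n j' ω| ≤ J n * b n := (Finset.abs_sum_le_sum_abs _ _).trans (by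
        calc ∑ j' ∈ Finset.range (J n), |I n j' ω| ≤ ∑ _j' ∈ Finset.range (J n), b n := Finset.sum_le_sum fun j' _ => hIb j'
          _ = J n * b n := by rw [Finset.sum_const, Finset.card_range, nsmul_eq_mul])
      calc ((J n : ℝ) * b n)⁻¹ * |∑ j' ∈ Finset.range (J n), I n j' ω| ≤ ((J n : ℝ) * b n)⁻¹ * (J n * b n) :=
            mul_le_mul_of_nonneg_left h1 (by positivity)
        _ = 1 := inv_mul_cancel₀ (by positivity)
    have hsq : ∀ j, (I n j ω / b n - ((J n : ℝ) * b n)⁻¹ * ∑ j' ∈ Finset.range (J n), I n j' ω) ^ 2 ≤ 4 := fun j => by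
      have h1 : |I n j ω / b n - ((J n : ℝ) * b n)⁻¹ * ∑ j' ∈ Finset.range (J n), I n j' ω| ≤ 2 :=
        (abs_sub _ _).trans (by linarith [ha j, hmean])
      rw [← sq_abs]; nlinarith [abs_nonneg (I n j ω / b n - ((J n : ℝ) * b n)⁻¹ * ∑ j' ∈ Finset.range (J n), I n j' ω)]
    simp only [hest]
    rw [abs_mul, abs_of_pos (by positivity : (0 : ℝ) < b n / J n), abs_of_nonneg (Finset.sum_nonneg fun j _ => sq_nonneg _)]
    calc b n / J n * ∑ j ∈ Finset.range (J n), (I n j ω / b n - ((J n : ℝ) * b n)⁻¹ * ∑ j' ∈ Finset.range (J n), I n j' ω) ^ 2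
        ≤ b n / J n * ∑ _j ∈ Finset.range (J n), (4 : ℝ) := mul_le_mul_of_nonneg_left (Finset.sum_le_sum fun j _ => hsq j) (by positivity)
      _ = 4 * b n := by rw [Finset.sum_const, Finset.card_range, nsmul_eq_mul]; field_simp
  have hV_meas : TendstoInMeasure P est atTop (fun _ => σ2) := by
    rw [tendstoInMeasure_iff_norm]
    intro ε hε
    have hreal_t : Tendsto (fun n => P.real {ω | ε ≤ ‖est n ω - σ2‖}) atTop (𝓝 0) := by
      refine tendsto_of_tendsto_of_tendsto_of_le_of_le tendsto_const_nhds ((hBd0.div_const ε).trans_eq (by simp)) (fun n => measureReal_nonneg)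
        fun n => ?_
      have hint : Integrable (fun ω => |est n ω - σ2|) P := (integrable_const (4 * b n + |σ2|)).mono'
        ((hestm n).sub measurable_const).abs.aestronglyMeasurable (Eventually.of_forall fun ω => by
          rw [Real.norm_eq_abs, abs_abs]; exact (abs_sub _ _).trans (add_le_add (hestb n ω) le_rfl))
      have hMk := mul_meas_ge_le_integral_of_nonneg (Eventually.of_forall fun ω => abs_nonneg (est n ω - σ2)) hint ε
      rw [le_div_iff₀ hε, mul_comm]
      simp only [Real.norm_eq_abs]
      exact hMk.trans (hL1 n)
    have h := ENNReal.tendsto_ofReal hreal_t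
    rw [ENNReal.ofReal_zero] at h
    refine h.congr fun n => ?_
    exact ofReal_measureReal
  refine ⟨hσ0, fun n => ⟨est n, hestm n, hestU n⟩, ?_⟩
  exact hV_meas.congr (fun n => (hestU n).symm) (ae_eq_refl _)

end Summit.QuantumFields.YangMills.Theorems.ColdStartUniversality

end
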